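import Summits.BirchSwinnertonDyer.BirchSwinnertonDyer.Theorems.KimAtThreeFineKatoKPortFrobeniusGenerator
import Summits.BirchSwinnertonDyer.BirchSwinnertonDyer.Theorems.KimAtThreeEulerLatticeIndex
import HarnessLib

/-!
# K-PORT glue: the Euler-lattice index `[Λ : 𝒪_K] = p^{v_p(q^f + 1 − D_f(a;q))}` from LOCAL data —
# a Frobenius lift `φ` of an UNRAMIFIED `K` (re-keying acc3's `relIndex_integer_eulerLattice`)
# (cell `bsd-addord`, seat w2-kport gen 7; `--supports stmt-BirchSwinnertonDyer-19560`, helper)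

HONEST FRAMING. Route W2 (`route-BirchSwinnertonDyer-KimAtThreeKolyvagin`), crux 19560
`KatoKuriharaPortThreeShared`; the E-side LATTICE LEMMA of the good-ANOMALOUS rows (items 19679 /
19599, support item 20397). acc3's `KimAtThreeEulerLatticeIndex.relIndex_integer_eulerLattice` (p521580)
computes the index of the Euler lattice `Λ = {y : (φ² − aφ + q)y ∈ 𝒪_K}` over `𝒪_K` for an isometric
`φ : K →ₐ[ℚ_[p]] K` under `hf : [K : ℚ_p] = f`, `hpow : φ^f = 1` (pointwise) and `hdist :` the powers
`φ^i`, `i < f`, pairwise distinct. This file supplies those three binders from the LOCAL hypotheses the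
analytic half of the lattice lemma already carries (`…KPortFrobeniusGenerator`): `K` unramified
(`hK : ‖x‖ < 1 → ‖x‖ ≤ ‖p‖`) and `φ` a FROBENIUS LIFT (`hφp : ‖x‖ ≤ 1 → ‖φ x − x^p‖ < 1`) — then `φ` is
automatically isometric (`KPort.norm_algHom_eq`), `φ^{[K:ℚ_p]} = 1` (`KPort.pow_finrank_apply_eq_of_frobeniusLift`)
and its lower powers are distinct (`KPort.eq_of_pow_eq_pow_of_frobeniusLift`). TOOL theorems only
(no definition, no named fact, no `sorry`); closes nothing by itself; nothing booked; BSD is not proved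
by any of this.

## What is proved (`K` : `[NormedAlgebra ℚ_[p] K] [IsUltrametricDist K] [FiniteDimensional ℚ_[p] K]`,
## `𝒪_K = Valued.integer K` for the scoped `NormedField.toValued`, as in acc3's file)

* **`relIndex_integer_eulerLattice_of_frobeniusLift`** (`hK`) (`φ`) (`hφp`) (`hf : [K:ℚ_p] = f`) (`a q : ℤ`)
  (`hN : q^f + 1 − D_f(a;q) ≠ 0` in `ℤ_p`) : `[Λ : 𝒪_K] = p ^ v_p(q^f + 1 − D_f(a;q))`;
* `relIndex_integer_eulerLattice_of_frobeniusLift'` — the same with `f := Module.finrank ℚ_[p] K`.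

References: J.-P. Serre, *Local Fields* (1979), Ch. III §5 [SerreLocalFields1979]; E. Artin, independence
of characters (Lang, *Algebra*, VI §4; Mathlib `linearIndependent_monoidHom`).
-/

noncomputable section

-- the cell's Theorems namespace repeats the summit name by design (D-0017)
set_option linter.dupNamespace false

open scoped NormedField
open Polynomial

namespace Summit.BirchSwinnertonDyer.BirchSwinnertonDyer.Theorems.KPort

open Summit.BirchSwinnertonDyer.BirchSwinnertonDyer.Theorems.KimAtThreeEulerLatticeIndex

variable {p : ℕ} [Fact p.Prime] {K : Type*} [NontriviallyNormedField K] [NormedAlgebra ℚ_[p] K]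
  [IsUltrametricDist K] [FiniteDimensional ℚ_[p] K]

/-- **The Euler-lattice index from local data.** Let `K ⊇ ℚ_p` be finite and UNRAMIFIED (`hK`), `φ` a
`ℚ_p`-algebra endomorphism lifting the `p`-power map of the residue field (`hφp`), `[K : ℚ_p] = f`, and
`a, q ∈ ℤ` with `N = q^f + 1 − D_f(a; q) ≠ 0`. Then the Euler lattice `Λ = {y : (φ² − aφ + q) y ∈ 𝒪_K}`
has index `[Λ : 𝒪_K] = p^{v_p(N)}` (acc3's `relIndex_integer_eulerLattice`, its binders `hφ`/`hpow`/`hdist`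
discharged by `…KPortFrobeniusGenerator`). [cite: SerreLocalFields1979, Ch. III §5] -/
theorem relIndex_integer_eulerLattice_of_frobeniusLift (hK : ∀ x : K, ‖x‖ < 1 → ‖x‖ ≤ ‖(p : K)‖)
    (φ : K →ₐ[ℚ_[p]] K) (hφp : ∀ x : K, ‖x‖ ≤ 1 → ‖φ x - x ^ p‖ < 1) {f : ℕ}
    (hf : Module.finrank ℚ_[p] K = f) (a q : ℤ)
    (hN : (q : ℤ_[p]) ^ f + 1 - (Polynomial.dickson 1 (q : ℤ_[p]) f).eval (a : ℤ_[p]) ≠ 0) :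
    (Valued.integer K).toAddSubgroup.relIndex
        ((Valued.integer K).toAddSubgroup.comap
          (aeval (φ : K →ₗ[ℚ_[p]] K) (X ^ 2 - C (a : ℚ_[p]) * X + C (q : ℚ_[p]))).toAddMonoidHom) =
      p ^ ((q : ℤ_[p]) ^ f + 1 - (Polynomial.dickson 1 (q : ℤ_[p]) f).eval (a : ℤ_[p])).valuation := by
  haveI : ProperSpace K := properSpace_of_finiteDimensional p K
  have hf0 : 0 < f := hf ▸ Module.finrank_pos
  refine relIndex_integer_eulerLattice φ (norm_algHom_eq φ) hf0 hf ?_ ?_ a q hN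
  · intro x
    rw [← hf]
    exact pow_finrank_apply_eq_of_frobeniusLift hK φ hφp x
  · intro i j hi hj h
    rw [← hf] at hi hj
    exact eq_of_pow_eq_pow_of_frobeniusLift hK φ hφp i j hi hj h

/-- The same index with `f := [K : ℚ_p]` literally. [cite: SerreLocalFields1979, Ch. III §5] -/
theorem relIndex_integer_eulerLattice_of_frobeniusLift' (hK : ∀ x : K, ‖x‖ < 1 → ‖x‖ ≤ ‖(p : K)‖)
    (φ : K →ₐ[ℚ_[p]] K) (hφp : ∀ x : K, ‖x‖ ≤ 1 → ‖φ x - x ^ p‖ < 1) (a q : ℤ)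
    (hN : (q : ℤ_[p]) ^ Module.finrank ℚ_[p] K + 1 -
      (Polynomial.dickson 1 (q : ℤ_[p]) (Module.finrank ℚ_[p] K)).eval (a : ℤ_[p]) ≠ 0) :
    (Valued.integer K).toAddSubgroup.relIndex
        ((Valued.integer K).toAddSubgroup.comap
          (aeval (φ : K →ₗ[ℚ_[p]] K) (X ^ 2 - C (a : ℚ_[p]) * X + C (q : ℚ_[p]))).toAddMonoidHom) =
      p ^ ((q : ℤ_[p]) ^ Module.finrank ℚ_[p] K + 1 -
        (Polynomial.dickson 1 (q : ℤ_[p]) (Module.finrank ℚ_[p] K)).eval (a : ℤ_[p])).valuation :=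
  relIndex_integer_eulerLattice_of_frobeniusLift hK φ hφp rfl a q hN

end Summit.BirchSwinnertonDyer.BirchSwinnertonDyer.Theorems.KPort

end
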